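import Summits.HodgeConjecture.HodgeConjecture.Theorems.HeckePrymWeilWeilTwelvefoldsSqrtMinus7SegreSlices
import Literature.AlgebraicGeometry.Motives.SegreEmbeddingPoints
import Literature.AlgebraicGeometry.HodgeTheory.HyperplaneClassRational
import Literature.AlgebraicTopology.CharacteristicClasses.TautologicalGysin
import HarnessLib

/-!
# Crux `WeilTwelvefoldsSqrtMinus7` (stmt-HodgeConjecture-1261), line `amnesic-secant-sheaves-split-fourteenfolds` — lemmas for stub `stub_symmetricSegreEmbedding` (β, r6), part II: the hyperplane class of the Segre embedding on `H²(–(ℂ); ℂ)`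

Helper file of the stub `stub_symmetricSegreEmbedding` (E. Markman, arXiv:2509.23403 §11.5 Step 2;
R. Hartshorne, *Algebraic Geometry* II Ex. 5.11–5.12: `σ^*𝒪(1) ≅ pr₁^*𝒪(1) ⊗ pr₂^*𝒪(1)` for the Segre
embedding `σ`). Main result `exists_segreHyperplaneClasses`: **a family of RATIONAL, non-zero
(`N ≥ 1`) classes `g_N ∈ H²(ℙᴺ_ℂ(ℂ); ℂ)` additive under every Segre embedding of
`Motives/SegreEmbedding`: `σ(ℂ)^* g = pr₁(ℂ)^* g + pr₂(ℂ)^* g`.**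

Construction and proof. Up to one complex scalar, `g_N` is the transport along Serre's comparison
homeomorphism `projPoint : ℙ(ℂᴺ⁺¹) ≃ₜ ℙᴺ_ℂ(ℂ)` (`isHomeomorph_projPoint`; the two dictionaries of
homogeneous coordinates agree, `projPoint_mk_eq_pointOfVec`) of the Euler class `e(γ¹)` of the tautological line bundle of `ℙ(ℂᴺ⁺¹)`
(`CharacteristicClasses.tautEuler`), which is NATURAL under all injective linear maps (`tautEuler_map`,
Husemoller Ch. 17 Prop. 3.3) and non-zero (`cup_tautEuler_surjective` with `dim H²(ℂℙᴺ; ℂ) = 1`). The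
lemmas are stated for any family `g` with `projPoint^* g_N = e(γ¹)_N` (hypothesis `hg`; such a family
exists, `exists_gen`). Along the slices `ℙⁿ × {[w₀]}`, `{[z₀]} × ℙᵐ` the Segre map IS the
projectivisation of the injective linear maps `z ↦ z ⊗ w₀`, `w ↦ z₀ ⊗ w`
(`ProjectiveSpace.map_segreEmbedding_lift_pointOfVec`), so both sides of the additivity formula agree on
the slices, which detect `H²` (part I, `eq_zero_of_slices`) — no coordinate permutation or homotopy is
needed. Rationality: `H²(ℙᴺ(ℂ); ℂ)` is a line spanned by a rational class
(`exists_isRationalClass_forall_eq_smul_projectiveSpace`), every `g_N` restricts to `g_1` along a line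
`ℙ¹ ⊂ ℙᴺ`, and two rational classes on a line differ by a rational factor (part I,
`exists_ratCast_eq_of_isRationalClass_smul`), so ONE complex scalar normalises all `N` at once.
Everything is proved; no named fact is taken.
-/

noncomputable section

-- every declaration of this problem lives in `Summit.HodgeConjecture.HodgeConjecture.…`
set_option linter.dupNamespace false

open CategoryTheory AlgebraicGeometry MonoidalCategory CartesianMonoidalCategory Function
open Literature.AlgebraicGeometry Literature.AlgebraicGeometry.Motives
  Literature.AlgebraicGeometry.HodgeTheory Literature.AlgebraicTopology.SingularHomology
  Literature.AlgebraicTopology.CharacteristicClasses Literature.NumberTheory.Transcendental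
open scoped LinearAlgebra.Projectivization

namespace Summit.HodgeConjecture.HodgeConjecture.Theorems.WeilTwelvefoldsSqrtMinus7.AmnesicSecantSheaves

attribute [local instance] MvPolynomial.gradedAlgebra

/-! ## The two dictionaries of homogeneous coordinates agree -/

/-- Serre's comparison point `projPoint N [v]` is the `ℂ`-point with homogeneous coordinates `v` of
`Motives/ProjectiveSpaceFieldPoints` (both lie in the same basic opens `D₊(f)`). [folklore] -/
theorem projPoint_mk_eq_pointOfVec (N : ℕ) (v : Fin (N + 1) → ℂ) (hv : v ≠ 0) :
    projPoint N (Projectivization.mk ℂ v hv) = ProjectiveSpace.pointOfVec ℂ v hv := by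
  refine ComplexPoints.ext_of_pt_eq ?_
  rw [projPoint_mk]
  refine Proj.ext_of_forall_mem_basicOpen_iff
    (MvPolynomial.homogeneousSubmodule (Fin (N + 1)) ℂ) fun m hm f hf ↦ ?_
  exact (Literature.NumberTheory.Transcendental.pt_pointOfVec_mem_basicOpen_iff N v hv hm hf).trans
    (Iff.trans Iff.rfl (ProjectiveSpace.pt_pointOfVec_mem_basicOpen_iff v hv hm hf).symm)

/-! ## Families of classes transporting `e(γ¹)` -/

section Gen

variable (g : (N : ℕ) → complexBetti (projectiveSpace N ℂ) 2)

/-- `g_0 = 0`: `H²(ℙ⁰_ℂ(ℂ); ℂ) = 0`. [folklore] -/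
theorem gen_zero : g 0 = 0 :=
  haveI : Subsingleton (complexBetti (projectiveSpace 0 ℂ) 2) :=
    ComplexPoints.subsingleton_singularCohomology_of_lt (isSmoothProjective_projectiveSpace' 0) ℂ (k := 2) (by omega)
  Subsingleton.elim _ _

/-- `e(γ¹) ≠ 0` in `H²(ℙ(ℂᴺ⁺¹); ℂ)` for `N ≥ 1` (every class of `H²` is `y ⌣ e(γ¹)`, and `H² ≠ 0`).
[cite: MilnorStasheff1974, §14 Thm. 14.4] -/
theorem tautEuler_ne_zero {N : ℕ} (hN : 1 ≤ N) : tautEuler (Fin (N + 1) → ℂ) ℂ 1 ≠ 0 := by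
  intro hx
  have hsurj := cup_tautEuler_surjective (Fin (N + 1) → ℂ) ℂ (n := N + 1) (Module.finrank_fin_fun ℂ) (by omega)
    (k := 0) (by omega)
  have h1 := Literature.Topology.FourManifolds.ComplexProjectiveSpace.finrank_singularCohomology_two_mul_eq_one ℂ N 1 hN
  have hall : ∀ c : singularCohomology ℂ ℂ (ℙ ℂ (Fin (N + 1) → ℂ)) 2, c = 0 := by
    intro c
    obtain ⟨y, rfl⟩ := hsurj c
    change cupProduct _ y (tautEuler (Fin (N + 1) → ℂ) ℂ 1) = 0
    rw [hx, map_zero]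
  haveI : Subsingleton (singularCohomology ℂ ℂ (ℙ ℂ (Fin (N + 1) → ℂ)) 2) :=
    subsingleton_of_forall_eq 0 hall
  have h0 : Module.finrank ℂ (singularCohomology ℂ ℂ (ℙ ℂ (Fin (N + 1) → ℂ)) 2) = 0 :=
    Module.finrank_zero_of_subsingleton
  exact one_ne_zero (h1.symm.trans h0)

/-- **There is a family `g` transporting `e(γ¹)`**: `g_N :=` the pull-back of `e(γ¹)_N` along
`projPoint⁻¹ : ℙᴺ_ℂ(ℂ) → ℙ(ℂᴺ⁺¹)`. [folklore] -/
theorem exists_gen : ∃ g : (N : ℕ) → complexBetti (projectiveSpace N ℂ) 2, ∀ N : ℕ,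
    singularCohomology.map ℂ ℂ (⟨projPoint N, (isHomeomorph_projPoint N).continuous⟩ :
      C(ℙ ℂ (Fin (N + 1) → ℂ), ComplexPoints (projectiveSpace N ℂ))) 2 (g N) = tautEuler (Fin (N + 1) → ℂ) ℂ 1 := by
  refine ⟨fun N ↦ singularCohomology.map ℂ ℂ ((isHomeomorph_projPoint N).homeomorph.symm :
      C(ComplexPoints (projectiveSpace N ℂ), ℙ ℂ (Fin (N + 1) → ℂ))) 2 (tautEuler (Fin (N + 1) → ℂ) ℂ 1), fun N ↦ ?_⟩
  have hc : ((isHomeomorph_projPoint N).homeomorph.symm :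
      C(ComplexPoints (projectiveSpace N ℂ), ℙ ℂ (Fin (N + 1) → ℂ))).comp
      (⟨projPoint N, (isHomeomorph_projPoint N).continuous⟩ :
        C(ℙ ℂ (Fin (N + 1) → ℂ), ComplexPoints (projectiveSpace N ℂ))) = ContinuousMap.id _ :=
    ContinuousMap.ext fun p ↦ (isHomeomorph_projPoint N).homeomorph.symm_apply_apply p
  rw [← ModuleCat.comp_apply, ← singularCohomology.map_comp, hc, singularCohomology.map_id]
  rfl

variable (hg : ∀ N : ℕ, singularCohomology.map ℂ ℂ (⟨projPoint N, (isHomeomorph_projPoint N).continuous⟩ :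
      C(ℙ ℂ (Fin (N + 1) → ℂ), ComplexPoints (projectiveSpace N ℂ))) 2 (g N) = tautEuler (Fin (N + 1) → ℂ) ℂ 1)
include hg

/-- `g_N` is the pull-back of `e(γ¹)_N` along `projPoint⁻¹`. [folklore] -/
theorem gen_eq (N : ℕ) : g N = singularCohomology.map ℂ ℂ ((isHomeomorph_projPoint N).homeomorph.symm :
      C(ComplexPoints (projectiveSpace N ℂ), ℙ ℂ (Fin (N + 1) → ℂ))) 2 (tautEuler (Fin (N + 1) → ℂ) ℂ 1) := by
  have hc : (⟨projPoint N, (isHomeomorph_projPoint N).continuous⟩ :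
        C(ℙ ℂ (Fin (N + 1) → ℂ), ComplexPoints (projectiveSpace N ℂ))).comp
      ((isHomeomorph_projPoint N).homeomorph.symm :
        C(ComplexPoints (projectiveSpace N ℂ), ℙ ℂ (Fin (N + 1) → ℂ))) = ContinuousMap.id _ := by
    refine ContinuousMap.ext fun p ↦ ?_
    have h := (isHomeomorph_projPoint N).homeomorph.apply_symm_apply p
    rwa [IsHomeomorph.homeomorph_apply] at h
  rw [← hg N, ← ModuleCat.comp_apply, ← singularCohomology.map_comp, hc, singularCohomology.map_id]
  rfl

/-- `g_N ≠ 0` for `N ≥ 1`. [folklore] -/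
theorem gen_ne_zero {N : ℕ} (hN : 1 ≤ N) : g N ≠ 0 := fun h ↦
  tautEuler_ne_zero hN (by rw [← hg N, h, map_zero])

/-! ## The Segre embedding on `H²`: `σ^* g = pr₁^* g + pr₂^* g` -/

/-- **The hyperplane class of the Segre embedding** on the complex points: for the Segre map
`σ : ℙⁿ ×_ℂ ℙᵐ → ℙⁿᵐ⁺ⁿ⁺ᵐ` of `Motives/SegreEmbedding` and a family `g` transporting the Euler classes of
the tautological line bundles, `σ(ℂ)^* g = pr₁(ℂ)^* g + pr₂(ℂ)^* g` in `H²((ℙⁿ × ℙᵐ)(ℂ); ℂ)`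
(`σ^*𝒪(1) = 𝒪(1, 1)`). Proof: both sides agree on the two slices `ℙⁿ × {[w₀]}`, `{[z₀]} × ℙᵐ`, along
which `σ` is the projectivisation of the injective linear maps `z ↦ z ⊗ w₀`, `w ↦ z₀ ⊗ w`
(`map_segreEmbedding_lift_pointOfVec`) so that naturality of `e(γ¹)` applies (`tautEuler_map`), and the
two slices detect `H²` (`eq_zero_of_slices`). [cite: Hartshorne1977, II Ex. 5.11 and Ex. 5.12] -/
theorem map_segreEmbedding_gen (n m : ℕ) :
    complexBetti.map (segreEmbedding n m ℂ) 2 (g (n * m + n + m)) =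
      complexBetti.map (fst (projectiveSpace n ℂ) (projectiveSpace m ℂ)) 2 (g n) +
        complexBetti.map (snd (projectiveSpace n ℂ) (projectiveSpace m ℂ)) 2 (g m) := by
  -- two base points
  have hz₀ : (fun _ ↦ (1 : ℂ) : Fin (n + 1) → ℂ) ≠ 0 := Function.ne_iff.2 ⟨0, one_ne_zero⟩
  have hw₀ : (fun _ ↦ (1 : ℂ) : Fin (m + 1) → ℂ) ≠ 0 := Function.ne_iff.2 ⟨0, one_ne_zero⟩
  set z₀ : Fin (n + 1) → ℂ := fun _ ↦ 1 with hz₀def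
  set w₀ : Fin (m + 1) → ℂ := fun _ ↦ 1 with hw₀def
  set P₀ : ComplexPoints (projectiveSpace n ℂ) := projPoint n (Projectivization.mk ℂ z₀ hz₀) with hP₀
  set Q₀ : ComplexPoints (projectiveSpace m ℂ) := projPoint m (Projectivization.mk ℂ w₀ hw₀) with hQ₀
  set e := segreIndexEquiv n m with he
  -- the two slices
  set ιL : C(ComplexPoints (projectiveSpace n ℂ), ComplexPoints (projectiveSpace n ℂ ⊗ projectiveSpace m ℂ)) :=
    ⟨fun P' ↦ AlgPoints.prodEquiv.symm (P', Q₀),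
      AlgPoints.continuous_prodEquiv_symm.comp (continuous_id.prodMk continuous_const)⟩ with hιL
  set ιR : C(ComplexPoints (projectiveSpace m ℂ), ComplexPoints (projectiveSpace n ℂ ⊗ projectiveSpace m ℂ)) :=
    ⟨fun Q' ↦ AlgPoints.prodEquiv.symm (P₀, Q'),
      AlgPoints.continuous_prodEquiv_symm.comp (continuous_const.prodMk continuous_id)⟩ with hιR
  -- the two linear slices of the Segre map
  let Aw : (Fin (n + 1) → ℂ) →ₗ[ℂ] (Fin (n * m + n + m + 1) → ℂ) :=
    { toFun := fun z t ↦ z (e.symm t).1 * w₀ (e.symm t).2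
      map_add' := fun a b ↦ funext fun t ↦ by simp only [Pi.add_apply]; ring
      map_smul' := fun c a ↦ funext fun t ↦ by
        simp only [Pi.smul_apply, smul_eq_mul, RingHom.id_apply]; ring }
  have hAw : Injective Aw := by
    intro a b hab
    funext i
    have h := congrFun hab (e (i, 0))
    simp only [Aw, LinearMap.coe_mk, AddHom.coe_mk, Equiv.symm_apply_apply, hw₀def, mul_one] at h
    exact h
  let Bz : (Fin (m + 1) → ℂ) →ₗ[ℂ] (Fin (n * m + n + m + 1) → ℂ) :=
    { toFun := fun w t ↦ z₀ (e.symm t).1 * w (e.symm t).2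
      map_add' := fun a b ↦ funext fun t ↦ by simp only [Pi.add_apply]; ring
      map_smul' := fun c a ↦ funext fun t ↦ by
        simp only [Pi.smul_apply, smul_eq_mul, RingHom.id_apply]; ring }
  have hBz : Injective Bz := by
    intro a b hab
    funext j
    have h := congrFun hab (e (0, j))
    simp only [Bz, LinearMap.coe_mk, AddHom.coe_mk, Equiv.symm_apply_apply, hz₀def, one_mul] at h
    exact h
  -- along the slices the Segre map is a projectivised linear map
  have hcompL : (AlgPoints.mapContinuous (L := ℂ) (segreEmbedding n m ℂ)).comp ιL =
      (⟨projPoint (n * m + n + m), (isHomeomorph_projPoint (n * m + n + m)).continuous⟩ :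
      C(ℙ ℂ (Fin (n * m + n + m + 1) → ℂ), ComplexPoints (projectiveSpace (n * m + n + m) ℂ))).comp
        ((projMapC Aw hAw).comp ((isHomeomorph_projPoint n).homeomorph.symm :
      C(ComplexPoints (projectiveSpace n ℂ), ℙ ℂ (Fin (n + 1) → ℂ)))) := by
    refine ContinuousMap.ext fun P ↦ ?_
    obtain ⟨p, rfl⟩ := projPoint_surjective n P
    induction p using Projectivization.ind with
    | h z hz =>
      have hs : (isHomeomorph_projPoint n).homeomorph.symm (projPoint n (Projectivization.mk ℂ z hz)) =
          Projectivization.mk ℂ z hz := by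
        have h := (isHomeomorph_projPoint n).homeomorph.symm_apply_apply (Projectivization.mk ℂ z hz)
        rwa [IsHomeomorph.homeomorph_apply] at h
      change AlgPoints.map (segreEmbedding n m ℂ) (AlgPoints.prodEquiv.symm (projPoint n (Projectivization.mk ℂ z hz), Q₀)) =
        projPoint (n * m + n + m) (Projectivization.map Aw hAw
          ((isHomeomorph_projPoint n).homeomorph.symm (projPoint n (Projectivization.mk ℂ z hz))))
      rw [hs, Projectivization.map_mk, projPoint_mk_eq_pointOfVec, hQ₀,
        projPoint_mk_eq_pointOfVec, projPoint_mk_eq_pointOfVec, AlgPoints.prodEquiv_symm_apply,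
        ProjectiveSpace.map_segreEmbedding_lift_pointOfVec]
      rfl
  have hcompR : (AlgPoints.mapContinuous (L := ℂ) (segreEmbedding n m ℂ)).comp ιR =
      (⟨projPoint (n * m + n + m), (isHomeomorph_projPoint (n * m + n + m)).continuous⟩ :
      C(ℙ ℂ (Fin (n * m + n + m + 1) → ℂ), ComplexPoints (projectiveSpace (n * m + n + m) ℂ))).comp
        ((projMapC Bz hBz).comp ((isHomeomorph_projPoint m).homeomorph.symm :
      C(ComplexPoints (projectiveSpace m ℂ), ℙ ℂ (Fin (m + 1) → ℂ)))) := by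
    refine ContinuousMap.ext fun Q ↦ ?_
    obtain ⟨q, rfl⟩ := projPoint_surjective m Q
    induction q using Projectivization.ind with
    | h w hw =>
      have hs : (isHomeomorph_projPoint m).homeomorph.symm (projPoint m (Projectivization.mk ℂ w hw)) =
          Projectivization.mk ℂ w hw := by
        have h := (isHomeomorph_projPoint m).homeomorph.symm_apply_apply (Projectivization.mk ℂ w hw)
        rwa [IsHomeomorph.homeomorph_apply] at h
      change AlgPoints.map (segreEmbedding n m ℂ) (AlgPoints.prodEquiv.symm (P₀, projPoint m (Projectivization.mk ℂ w hw))) =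
        projPoint (n * m + n + m) (Projectivization.map Bz hBz
          ((isHomeomorph_projPoint m).homeomorph.symm (projPoint m (Projectivization.mk ℂ w hw))))
      rw [hs, Projectivization.map_mk, projPoint_mk_eq_pointOfVec, hP₀,
        projPoint_mk_eq_pointOfVec, projPoint_mk_eq_pointOfVec, AlgPoints.prodEquiv_symm_apply,
        ProjectiveSpace.map_segreEmbedding_lift_pointOfVec]
      rfl
  -- the values on the slices
  have kL : singularCohomology.map ℂ ℂ ιL 2 (complexBetti.map (segreEmbedding n m ℂ) 2 (g (n * m + n + m))) = g n := by
    rw [complexBetti.map, ← ModuleCat.comp_apply, ← singularCohomology.map_comp, hcompL,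
      singularCohomology.map_comp, singularCohomology.map_comp, ModuleCat.comp_apply, ModuleCat.comp_apply,
      hg, ← tautEuler_map, ← gen_eq g hg n]
  have kR : singularCohomology.map ℂ ℂ ιR 2 (complexBetti.map (segreEmbedding n m ℂ) 2 (g (n * m + n + m))) = g m := by
    rw [complexBetti.map, ← ModuleCat.comp_apply, ← singularCohomology.map_comp, hcompR,
      singularCohomology.map_comp, singularCohomology.map_comp, ModuleCat.comp_apply, ModuleCat.comp_apply,
      hg, ← tautEuler_map, ← gen_eq g hg m]
  have h1 : singularCohomology.map ℂ ℂ ιL 2 (complexBetti.map (fst _ _) 2 (g n)) = g n := by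
    rw [complexBetti.map, ← ModuleCat.comp_apply, ← singularCohomology.map_comp, hιL, fst_comp_sliceL,
      singularCohomology.map_id, ModuleCat.id_apply]
  have h2 : singularCohomology.map ℂ ℂ ιL 2 (complexBetti.map (snd _ _) 2 (g m)) = 0 := by
    rw [complexBetti.map, ← ModuleCat.comp_apply, ← singularCohomology.map_comp]
    exact map_two_eq_zero_of_factors _ Q₀ (snd_comp_sliceL n m Q₀) _
  have h3 : singularCohomology.map ℂ ℂ ιR 2 (complexBetti.map (fst _ _) 2 (g n)) = 0 := by
    rw [complexBetti.map, ← ModuleCat.comp_apply, ← singularCohomology.map_comp]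
    exact map_two_eq_zero_of_factors _ P₀ (fst_comp_sliceR n m P₀) _
  have h4 : singularCohomology.map ℂ ℂ ιR 2 (complexBetti.map (snd _ _) 2 (g m)) = g m := by
    rw [complexBetti.map, ← ModuleCat.comp_apply, ← singularCohomology.map_comp, hιR, snd_comp_sliceR,
      singularCohomology.map_id, ModuleCat.id_apply]
  -- conclude by the detection of `H²` along the slices
  refine sub_eq_zero.1 (eq_zero_of_slices n m P₀ Q₀ _ ?_ ?_)
  · rw [← hιL, map_sub, map_add, kL, h1, h2, add_zero, sub_self]
  · rw [← hιR, map_sub, map_add, kR, h3, h4, zero_add, sub_self]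

/-! ## Normalising `g` to a rational class, uniformly in `N` -/

/-- **A line in `ℙᴺ`** (`N ≥ 1`): a continuous map `ℓ : ℙ¹(ℂ) → ℙᴺ(ℂ)` with `ℓ^* g_N = g_1` — the
projectivisation of a linear injection `ℂ² ↪ ℂᴺ⁺¹`, by naturality of `e(γ¹)`.
[cite: MilnorStasheff1974, §14 p. 158] -/
theorem exists_line_map_gen {N : ℕ} (hN : 1 ≤ N) :
    ∃ ℓ : C(ComplexPoints (projectiveSpace 1 ℂ), ComplexPoints (projectiveSpace N ℂ)),
      singularCohomology.map ℂ ℂ ℓ 2 (g N) = g 1 := by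
  have h2 : 1 + 1 ≤ N + 1 := by omega
  let Lℓ : (Fin (1 + 1) → ℂ) →ₗ[ℂ] (Fin (N + 1) → ℂ) := ExtendByZero.linearMap ℂ (Fin.castLE h2)
  have hLℓ : Injective Lℓ := by
    intro a b hab
    funext i
    have h := congrFun hab (Fin.castLE h2 i)
    simp only [Lℓ, ExtendByZero.linearMap_apply, (Fin.castLE_injective h2).extend_apply] at h
    exact h
  refine ⟨(⟨projPoint N, (isHomeomorph_projPoint N).continuous⟩ :
      C(ℙ ℂ (Fin (N + 1) → ℂ), ComplexPoints (projectiveSpace N ℂ))).comp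
    ((projMapC Lℓ hLℓ).comp ((isHomeomorph_projPoint 1).homeomorph.symm :
      C(ComplexPoints (projectiveSpace 1 ℂ), ℙ ℂ (Fin (1 + 1) → ℂ)))), ?_⟩
  rw [singularCohomology.map_comp, singularCohomology.map_comp, ModuleCat.comp_apply, ModuleCat.comp_apply,
    hg, ← tautEuler_map, ← gen_eq g hg 1]

/-- **Uniform rational normalisation**: there is `u ∈ ℂ`, `u ≠ 0`, such that `u • g_N` is a rational
class for every `N` (`H²(ℙᴺ(ℂ); ℂ)` is a line spanned by a rational class, all `g_N` restrict to `g_1`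
along lines, and rational classes on a line differ by rational factors). [cite: VoisinHodgeI2002, §7.1.1 and §11.3] -/
theorem exists_smul_gen_isRationalClass : ∃ u : ℂ, u ≠ 0 ∧ ∀ N : ℕ, IsRationalClass (u • g N) := by
  obtain ⟨r₁, hr₁, hgen₁⟩ := exists_isRationalClass_forall_eq_smul_projectiveSpace 1
  obtain ⟨z₁, hz₁⟩ := hgen₁ (g 1)
  have hg₁ : g 1 ≠ 0 := gen_ne_zero g hg le_rfl
  have hz₁0 : z₁ ≠ 0 := fun h ↦ hg₁ (by rw [hz₁, h, zero_smul])
  have hr₁0 : r₁ ≠ 0 := fun h ↦ hg₁ (by rw [hz₁, h, smul_zero])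
  refine ⟨z₁⁻¹, inv_ne_zero hz₁0, fun N ↦ ?_⟩
  rcases Nat.eq_zero_or_pos N with rfl | hN
  · rw [gen_zero g, smul_zero]
    exact IsRationalClass.zero
  obtain ⟨r, hr, hgen⟩ := exists_isRationalClass_forall_eq_smul_projectiveSpace N
  obtain ⟨zN, hzN⟩ := hgen (g N)
  have hgN : g N ≠ 0 := gen_ne_zero g hg hN
  have hzN0 : zN ≠ 0 := fun h ↦ hgN (by rw [hzN, h, zero_smul])
  obtain ⟨ℓ, hℓ⟩ := exists_line_map_gen g hg hN
  -- `ℓ^* r = (z₁ / zN) • r₁` is rational, so `z₁ / zN ∈ ℚ`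
  have hℓr : singularCohomology.map ℂ ℂ ℓ 2 r = (z₁ / zN) • r₁ := by
    have h : zN • singularCohomology.map ℂ ℂ ℓ 2 r = z₁ • r₁ := by
      rw [← map_smul, ← hzN, hℓ, hz₁]
    rw [div_eq_mul_inv, mul_comm, mul_smul, ← h, smul_smul, inv_mul_cancel₀ hzN0, one_smul]
  obtain ⟨q, hq⟩ := exists_ratCast_eq_of_isRationalClass_smul hr₁ hr₁0 (z := z₁ / zN)
    (by rw [← hℓr]; exact hr.pullback ℓ)
  have hq0 : q ≠ 0 := by
    rintro rfl
    rw [Rat.cast_zero] at hq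
    exact div_ne_zero hz₁0 hzN0 hq.symm
  have hkey : z₁⁻¹ • g N = ((q⁻¹ : ℚ) : ℂ) • r := by
    rw [hzN, smul_smul, Rat.cast_inv, hq, inv_div, div_eq_mul_inv, mul_comm]
  rw [hkey]
  exact hr.smul q⁻¹

end Gen

/-! ## The packaged statement -/

/-- **Hyperplane classes of Segre embeddings on `H²(–(ℂ); ℂ)`.** There is a family of RATIONAL classes
`g_N ∈ H²(ℙᴺ_ℂ(ℂ); ℂ)`, non-zero for `N ≥ 1` (hence generators of the line `H²(ℙᴺ(ℂ); ℂ)`), which is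
ADDITIVE under every Segre embedding `σ : ℙⁿ ×_ℂ ℙᵐ ↪ ℙⁿᵐ⁺ⁿ⁺ᵐ` of `Motives/SegreEmbedding`:
`σ(ℂ)^* g = pr₁(ℂ)^* g + pr₂(ℂ)^* g` — the Betti shadow of `σ^*𝒪(1) ≅ pr₁^*𝒪(1) ⊗ pr₂^*𝒪(1)`
(Hartshorne II Ex. 5.11–5.12). Here `g_N` is a fixed rational multiple of the Euler class of the
tautological line bundle of `ℙ(ℂᴺ⁺¹)` transported along Serre's `projPoint : ℙ(ℂᴺ⁺¹) ≃ₜ ℙᴺ_ℂ(ℂ)`.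
[cite: Hartshorne1977, II Ex. 5.11 and Ex. 5.12] [cite: MilnorStasheff1974, §14 p. 158] -/
theorem exists_segreHyperplaneClasses :
    ∃ g : (N : ℕ) → complexBetti (projectiveSpace N ℂ) 2,
      (∀ N : ℕ, IsRationalClass (g N)) ∧ (∀ N : ℕ, 1 ≤ N → g N ≠ 0) ∧
      ∀ n m : ℕ, complexBetti.map (segreEmbedding n m ℂ) 2 (g (n * m + n + m)) =
        complexBetti.map (CartesianMonoidalCategory.fst (projectiveSpace n ℂ) (projectiveSpace m ℂ)) 2 (g n) +
          complexBetti.map (CartesianMonoidalCategory.snd (projectiveSpace n ℂ) (projectiveSpace m ℂ)) 2 (g m) := by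
  obtain ⟨g, hg⟩ := exists_gen
  obtain ⟨u, hu, hrat⟩ := exists_smul_gen_isRationalClass g hg
  refine ⟨fun N ↦ u • g N, hrat, fun N hN ↦ smul_ne_zero hu (gen_ne_zero g hg hN), fun n m ↦ ?_⟩
  simp only [map_smul, map_segreEmbedding_gen g hg, smul_add]

end Summit.HodgeConjecture.HodgeConjecture.Theorems.WeilTwelvefoldsSqrtMinus7.AmnesicSecantSheaves

end
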